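import Literature.AlgebraicGeometry.Motives.LinearCohomologyEllAdicTower
import HarnessLib

/-!
# `lim_m ℤ/ℓᵐ = ℤ_ℓ` for the tower of `LinearCohomologyEllAdicTower.lean`

The inverse limit (`towerLim`, `EllAdicComparison.lean`) of the tower of rings
`ZModPow ℓ m = ℤ/ℓᵐ` along the reductions `zmodPowRed ℓ m : ℤ/ℓᵐ⁺¹ → ℤ/ℓᵐ` is the ring of `ℓ`-adic
integers: `padicIntEquivZModPowTowerLim ℓ : ℤ_[ℓ] ≃ₗ[ℤ_ℓ] towerLim (zmodPowTower ℓ)`, `z ↦ (z mod ℓᵐ)ₘ`,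
`ℤ_ℓ`-linear for the canonical module structure `(x • a)_m = (x mod ℓᵐ) a_m`
(`towerLim.instModulePadicInt`); bijectivity is Mathlib's `PadicInt.ext_of_toZModPow` and
`PadicInt.toZModPow_ofIntSeq_of_pow_dvd_sub` (Milne V §1: `ℤ_l = lim ℤ/lⁿℤ`). This is the value on
a point of the `ℓ`-adic tower `lim_m H⁰(–_ét, ℤ/ℓᵐ)`.

## References

* J. S. Milne, *Étale cohomology* (reissue 2025; `book:milne2025-etale-cohomology`): V §1
  (PDF p. 176: `ℤ_l = lim ℤ/lⁿℤ`). [Milne2025]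
* Mathlib: `PadicInt.toZModPow`, `PadicInt.cast_toZModPow`, `PadicInt.ofIntSeq`,
  `PadicInt.toZModPow_ofIntSeq_of_pow_dvd_sub`, `PadicInt.ext_of_toZModPow`.
-/

universe w

namespace Literature.AlgebraicGeometry.Motives

variable (ℓ : ℕ) [hℓ : Fact ℓ.Prime]

/-- The tower `(ℤ/ℓᵐ)ₘ` along the reductions, as additive maps. [folklore] -/
abbrev zmodPowTower (m : ℕ) : ZModPow.{w} ℓ (m + 1) →+ ZModPow.{w} ℓ m :=
  (zmodPowRed.{w} ℓ m).toAddMonoidHom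

omit hℓ in
/-- `zmodPowRed` on components: reduce the underlying class. [folklore] -/
theorem zmodPowRed_up (m : ℕ) (a : ZMod (ℓ ^ (m + 1))) :
    zmodPowRed.{w} ℓ m (ULift.up a) = ULift.up (ZMod.cast a : ZMod (ℓ ^ m)) :=
  rfl

/-- `ℓᵐ` kills every `ℤ/ℓᵐ`-module, in particular `ℤ/ℓᵐ` itself: the torsion hypothesis of
`towerLim.instModulePadicInt` for the tower `(ℤ/ℓᵐ)ₘ`. [folklore] -/
instance fact_pow_smul_zmodPow_eq_zero :
    Fact (∀ m (a : ZModPow.{w} ℓ m), ℓ ^ m • a = 0) :=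
  ⟨fun m a => by
    rw [← Nat.cast_smul_eq_nsmul (ZModPow.{w} ℓ m)]
    have : ((ℓ ^ m : ℕ) : ZModPow.{w} ℓ m) = 0 := by
      apply ULift.ext
      change ((ℓ ^ m : ℕ) : ZMod (ℓ ^ m)) = 0
      exact ZMod.natCast_self _
    rw [this, zero_smul]⟩

/-- **`ℤ_ℓ → lim_m ℤ/ℓᵐ`, `z ↦ (z mod ℓᵐ)ₘ`** (a compatible family by `PadicInt.cast_toZModPow`),
additive. [cite: Milne2025, V §1 (p. 176)] -/
noncomputable def padicIntToZModPowTowerLim : ℤ_[ℓ] →+ towerLim (zmodPowTower.{w} ℓ) where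
  toFun z := ⟨fun m => ULift.up (PadicInt.toZModPow m z), (mem_towerLim_iff _).2 fun m => by
    change zmodPowRed.{w} ℓ m (ULift.up (PadicInt.toZModPow (m + 1) z)) = _
    rw [zmodPowRed_up]
    exact congrArg ULift.up (PadicInt.cast_toZModPow m (m + 1) m.le_succ z)⟩
  map_zero' := Subtype.ext <| funext fun m => by
    change ULift.up (PadicInt.toZModPow m 0) = 0
    rw [map_zero]
    rfl
  map_add' x y := Subtype.ext <| funext fun m => by
    change ULift.up (PadicInt.toZModPow m (x + y)) =
      ULift.up (PadicInt.toZModPow m x) + ULift.up (PadicInt.toZModPow m y)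
    rw [map_add]
    rfl

/-- Components: `(z mod ℓ•)_m = z mod ℓᵐ`. [folklore] -/
@[simp]
theorem coe_padicIntToZModPowTowerLim_apply (z : ℤ_[ℓ]) (m : ℕ) :
    (padicIntToZModPowTowerLim.{w} ℓ z : ∀ m, ZModPow.{w} ℓ m) m = ULift.up (PadicInt.toZModPow m z) :=
  rfl

/-- `z ↦ (z mod ℓᵐ)ₘ` is injective (Mathlib `PadicInt.ext_of_toZModPow`). [folklore] -/
theorem padicIntToZModPowTowerLim_injective :
    Function.Injective (padicIntToZModPowTowerLim.{w} ℓ) := fun x y h =>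
  PadicInt.ext_of_toZModPow.1 fun m => by
    have := congrArg (fun a : towerLim (zmodPowTower.{w} ℓ) => ((a : ∀ m, ZModPow.{w} ℓ m) m).down) h
    exact this

/-- `z ↦ (z mod ℓᵐ)ₘ` is surjective: a compatible family `(a_m)` lifts to the `ℓ`-adic integer
defined by the Cauchy sequence of representatives (Mathlib `PadicInt.ofIntSeq`,
`toZModPow_ofIntSeq_of_pow_dvd_sub`). [cite: Milne2025, V §1 (p. 176)] -/
theorem padicIntToZModPowTowerLim_surjective :
    Function.Surjective (padicIntToZModPowTowerLim.{w} ℓ) := fun a => by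
  let f : ℕ → ℤ := fun m => (((a : ∀ m, ZModPow.{w} ℓ m) m).down.val : ℤ)
  have hf : ∀ i, (ℓ : ℤ) ^ i ∣ f (i + 1) - f i := fun i => by
    have hc : (ZMod.cast ((a : ∀ m, ZModPow.{w} ℓ m) (i + 1)).down : ZMod (ℓ ^ i)) =
        ((a : ∀ m, ZModPow.{w} ℓ m) i).down :=
      congrArg ULift.down ((mem_towerLim_iff _).1 a.2 i)
    rw [ZMod.cast_eq_val] at hc
    have h' : (((((a : ∀ m, ZModPow.{w} ℓ m) (i + 1)).down.val : ℤ)) : ZMod (ℓ ^ i)) =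
        ((((a : ∀ m, ZModPow.{w} ℓ m) i).down.val : ℤ) : ZMod (ℓ ^ i)) := by
      rw [Int.cast_natCast, Int.cast_natCast, hc, ZMod.natCast_zmod_val]
    have hd := (ZMod.intCast_eq_intCast_iff_dvd_sub _ _ _).1 h'
    rw [Nat.cast_pow] at hd
    rw [← dvd_neg, neg_sub]
    exact hd
  refine ⟨PadicInt.ofIntSeq f (PadicInt.isCauSeq_padicNorm_of_pow_dvd_sub f ℓ hf),
    Subtype.ext <| funext fun m => ?_⟩
  rw [coe_padicIntToZModPowTowerLim_apply, PadicInt.toZModPow_ofIntSeq_of_pow_dvd_sub f ℓ hf]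
  apply congrArg ULift.up
  change ((((a : ∀ m, ZModPow.{w} ℓ m) m).down.val : ℤ) : ZMod (ℓ ^ m)) = _
  rw [Int.cast_natCast, ZMod.natCast_zmod_val]

/-- **`ℤ_ℓ ≅ lim_m ℤ/ℓᵐ`** as `ℤ_ℓ`-modules (`z ↦ (z mod ℓᵐ)ₘ`; the `ℤ_ℓ`-action on the limit is
`(x • a)_m = (x mod ℓᵐ) a_m`, `towerLim.instModulePadicInt`). Milne V §1: `ℤ_l = lim ℤ/lⁿℤ`.
[cite: Milne2025, V §1 (p. 176)] -/
noncomputable def padicIntEquivZModPowTowerLim : ℤ_[ℓ] ≃ₗ[ℤ_[ℓ]] towerLim (zmodPowTower.{w} ℓ) :=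
  { AddEquiv.ofBijective (padicIntToZModPowTowerLim.{w} ℓ)
      ⟨padicIntToZModPowTowerLim_injective ℓ, padicIntToZModPowTowerLim_surjective ℓ⟩ with
    map_smul' := fun x z => Subtype.ext <| funext fun m => by
      change ULift.up (PadicInt.toZModPow m (x * z)) =
        (PadicInt.toZModPow m x).val • ULift.up (PadicInt.toZModPow m z)
      rw [map_mul]
      apply ULift.ext
      change PadicInt.toZModPow m x * PadicInt.toZModPow m z =
        (PadicInt.toZModPow m x).val • PadicInt.toZModPow m z
      rw [nsmul_eq_mul, ZMod.natCast_zmod_val] }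

/-- Components of `ℤ_ℓ ≅ lim_m ℤ/ℓᵐ`: `(e z)_m = z mod ℓᵐ`. [folklore] -/
@[simp]
theorem coe_padicIntEquivZModPowTowerLim_apply (z : ℤ_[ℓ]) (m : ℕ) :
    (padicIntEquivZModPowTowerLim.{w} ℓ z : ∀ m, ZModPow.{w} ℓ m) m =
      ULift.up (PadicInt.toZModPow m z) :=
  rfl

/-- `e⁻¹ a` is the `ℓ`-adic integer with residues `a_m`: `(e⁻¹ a) mod ℓᵐ = a_m`. [folklore] -/
theorem toZModPow_padicIntEquivZModPowTowerLim_symm (a : towerLim (zmodPowTower.{w} ℓ)) (m : ℕ) :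
    ULift.up (PadicInt.toZModPow m ((padicIntEquivZModPowTowerLim.{w} ℓ).symm a)) =
      (a : ∀ m, ZModPow.{w} ℓ m) m := by
  conv_rhs => rw [← (padicIntEquivZModPowTowerLim.{w} ℓ).apply_symm_apply a]
  rfl

/-- `e 1 = (1)ₘ`: the unit of `ℤ_ℓ` is the compatible family of units. [folklore] -/
theorem coe_padicIntEquivZModPowTowerLim_one (m : ℕ) :
    (padicIntEquivZModPowTowerLim.{w} ℓ 1 : ∀ m, ZModPow.{w} ℓ m) m = 1 := by
  rw [coe_padicIntEquivZModPowTowerLim_apply, map_one]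
  rfl

end Literature.AlgebraicGeometry.Motives
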